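import Summits.Ventures.PercRepro.Night2NearFatFourteen

/-!
# PercRepro — **THE `(7, 5)` SHADOW ROW MODULO THE RESIDUE `(2, 0)` AND THE Z7 NEAR-FAT CLAUSE OF `(2, 1)`** (night-2, gen 40)

The near-fat clause of gen 39 (`shadowHall_seven_five_of_residuesZ6`: a thin member missing exactly three points, no fat
closure, `11 ≤ |G| ≤ 16`) is reduced to its RESIDUE: `|G| ≤ 13`, or a line of `V` with exactly `8` points at `|G| = 15`, or at
`|G| = 14` a seven-point line or two distinct six-point lines — `|G| = 16` is CLOSED outright (`localShadowHall_sixteen`,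
Night2NearFatSixteenAll), `|G| = 15` up to the eight-point line (`localShadowHall_fifteen_of_no_eight_line`, Night2NearFatFifteen),
`|G| = 14` up to those lines (`localShadowHall_fourteen_of_one_six_line`, Night2NearFatFourteen);
`localShadowHall_two_one_of_near_fat_outside_residue` (Night2NearFatAssembly: a line with `≤ 5` points of `V` off it by gen
37's line theorem, short lines by the non-suspect families).  **`shadowHall_seven_five_of_residuesZ7`**: the row of record with the `(2, 1)` clause now carrying
that residue.  Paper: proofs/NIGHT-2-g40.md §7.
-/

namespace PercRepro.Shadow

open Finset PerFlat ThmH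

variable {α : Type*} [DecidableEq α] {M : Matroid α} [M.Finite] {G : Finset α}

/-- **h21's near-fat clause outside the Z7 residue**: no fat closure, `11 ≤ |G| ≤ 16`, and NOT (`|G| ≤ 13`, the eight-point line at
`|G| = 15`, a seven-point line or two six-point lines at `|G| = 14`) ⇒ the local Hall inequality. -/
theorem localShadowHall_two_one_of_near_fat_outside_residue (hG : G ∈ flatsQ M (5 + 1)) (hd : (gr M \ G).card = 2)
    (hk : kColoops M G = 1) (hs : ∀ e ∈ gr M, ∀ f ∈ gr M, e ≠ f → rkN M {e, f} = 2)
    (hl : ∀ e ∈ gr M, M.Indep {e}) (hnf : fatClosures M 5 G 2 = ∅) (h11 : 11 ≤ G.card) (h16 : G.card ≤ 16)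
    (hres : ¬ (G.card ≤ 13 ∨
      (G.card = 15 ∧ ∃ u ∈ G \ coloops M G, ∃ v ∈ G \ coloops M G, u ≠ v ∧
        ((G \ coloops M G) ∩ clF M {u, v}).card = 8) ∨
      (G.card = 14 ∧ ((∃ u ∈ G \ coloops M G, ∃ v ∈ G \ coloops M G, u ≠ v ∧
          ((G \ coloops M G) ∩ clF M {u, v}).card = 7) ∨
        ∃ u ∈ G \ coloops M G, ∃ v ∈ G \ coloops M G, ∃ u' ∈ G \ coloops M G, ∃ v' ∈ G \ coloops M G, u ≠ v ∧ u' ≠ v' ∧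
          ((G \ coloops M G) ∩ clF M {u, v}).card = 6 ∧ ((G \ coloops M G) ∩ clF M {u', v'}).card = 6 ∧
          clF M {u, v} ≠ clF M {u', v'})))) :
    LocalShadowHall M 5 G := by
  push Not at hres
  obtain ⟨h13, hl15, hl14⟩ := hres
  rcases Nat.lt_or_ge G.card 15 with h14 | h15
  · have h14' : G.card = 14 := by omega
    obtain ⟨hl7, hone⟩ := hl14 h14'
    apply localShadowHall_fourteen_of_one_six_line hG hd hk hs hl hnf h14'
    · intro u hu v hv huv
      have := hl7 u hu v hv huv
      omega
    · intro u hu v hv huv u' hu' v' hv' huv' h6 h6'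
      exact hone u hu v hv u' hu' v' hv' huv huv' h6 h6'
  · rcases Nat.lt_or_ge G.card 16 with h15' | h16'
    · have h15'' : G.card = 15 := by omega
      apply localShadowHall_fifteen_of_no_eight_line hG hd hk hs hl hnf h15''
      intro u hu v hv huv
      have := hl15 h15'' u hu v hv huv
      omega
    · have h16'' : G.card = 16 := by omega
      exact localShadowHall_sixteen hG hd hk hs hl hnf h16''

section SevenFiveZ7

variable {α' : Type} [DecidableEq α']

open scoped Classical in
/-- **THE `(7, 5)` SHADOW ROW FOR EVERY FINITE MATROID MODULO THE RESIDUE `(2, 0)` AND THE Z7 NEAR-FAT CLAUSE OF `(2, 1)`**: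
the `(2, 1)` clause now reads «a thin member missing exactly three points, no fat closure, `11 ≤ |G| ≤ 16`, and: `|G| ≤ 13`, or
a line of `V` with exactly `8` points at `|G| = 15`, or at `|G| = 14` a seven-point line or two distinct six-point lines». -/
theorem shadowHall_seven_five_of_residuesZ7
    (h20 : ∀ (N : Matroid α') [N.Finite] (G : Finset α'), CellHyp N G →
      (gr N \ G).card = 2 → kColoops N G = 0 → FatMember N G 6 3 →
      (FatBasis N G 6 2 ∨ FatMember N G 6 2) →
      (2 ≤ (fatClosures N 5 G 2).card ∨
        ∃ B ∈ thinMembers N 5 G, 2 < (G \ clF N B).card ∧ (G \ clF N B).card < 5) →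
      LocalShadowHall N 5 G)
    (h21 : ∀ (N : Matroid α') [N.Finite] (G : Finset α'), CellHyp N G →
      (gr N \ G).card = 2 → kColoops N G = 1 → FatMember N G 5 4 →
      (FatBasis N G 5 3 ∨ FatMember N G 5 3) →
      (∃ B ∈ thinMembers N 5 G, (G \ clF N B).card = 3) → fatClosures N 5 G 2 = ∅ →
      11 ≤ G.card → G.card ≤ 16 →
      (G.card ≤ 13 ∨
      (G.card = 15 ∧ ∃ u ∈ G \ coloops N G, ∃ v ∈ G \ coloops N G, u ≠ v ∧
        ((G \ coloops N G) ∩ clF N {u, v}).card = 8) ∨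
      (G.card = 14 ∧ ((∃ u ∈ G \ coloops N G, ∃ v ∈ G \ coloops N G, u ≠ v ∧
          ((G \ coloops N G) ∩ clF N {u, v}).card = 7) ∨
        ∃ u ∈ G \ coloops N G, ∃ v ∈ G \ coloops N G, ∃ u' ∈ G \ coloops N G, ∃ v' ∈ G \ coloops N G, u ≠ v ∧ u' ≠ v' ∧
          ((G \ coloops N G) ∩ clF N {u, v}).card = 6 ∧ ((G \ coloops N G) ∩ clF N {u', v'}).card = 6 ∧
          clF N {u, v} ≠ clF N {u', v'}))) →
      LocalShadowHall N 5 G)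
    (M : Matroid α') [M.Finite] : ShadowHall M 7 5 (phiK 7 5) := by
  apply shadowHall_seven_five_of_residuesZ6 h20
  intro N _ G hcell hd hk hfm hfb hnear hnf h11 h16
  have hs := hcell.1
  have hl := hcell.2.1
  have hG := hcell.2.2.2
  by_cases hres : G.card ≤ 13 ∨
      (G.card = 15 ∧ ∃ u ∈ G \ coloops N G, ∃ v ∈ G \ coloops N G, u ≠ v ∧
        ((G \ coloops N G) ∩ clF N {u, v}).card = 8) ∨
      (G.card = 14 ∧ ((∃ u ∈ G \ coloops N G, ∃ v ∈ G \ coloops N G, u ≠ v ∧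
          ((G \ coloops N G) ∩ clF N {u, v}).card = 7) ∨
        ∃ u ∈ G \ coloops N G, ∃ v ∈ G \ coloops N G, ∃ u' ∈ G \ coloops N G, ∃ v' ∈ G \ coloops N G, u ≠ v ∧ u' ≠ v' ∧
          ((G \ coloops N G) ∩ clF N {u, v}).card = 6 ∧ ((G \ coloops N G) ∩ clF N {u', v'}).card = 6 ∧
          clF N {u, v} ≠ clF N {u', v'}))
  · exact h21 N G hcell hd hk hfm hfb hnear hnf h11 h16 hres
  · exact localShadowHall_two_one_of_near_fat_outside_residue hG hd hk hs hl hnf h11 h16 hres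

end SevenFiveZ7

end PercRepro.Shadow
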